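import Literature.NumberTheory.Automorphic.GJUnfoldingData
import HarnessLib

/-!
# The archimedean factor `G_∅ = GL_n(K_∞)` of `GL_n(𝔸_K)` and the archimedean module of the determinant

Topic `NumberTheory/Automorphic`; namespace `Literature.NumberTheory.Automorphic`. Glue brick of
the discharge of `GodementJacquet1972_gjZeta_meromorphic` (Godement–Jacquet, LNM 260 (1972),
Thm. 13.8; first clause: absolute convergence of the global zeta integral): the product
decomposition `GL_n(𝔸_K) = H^∅ · G_∅ = GL_n(𝔸_K^∞) × GL_n(K_∞)` of the tree (`awayFactor`,
`placesFactor`, `awayDecomp` of `GJUnfoldingIntegral` at `T = ∅`) is compared with the tree's model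
`GL (Fin n) (mixedSpace K)` of `GL_n(K_∞)` (`GLn.toMixed`, `GLn.ofInfinite` of `AdelicGLnGlue`), so
that the archimedean integral can be computed on the real group:

* `sndHom_coe_placesFactor_empty` — elements of `G_∅` have finite part `1`;
* `placesFactorEmptyEquiv K n : placesFactor K n ∅ ≃* GL (Fin n) (mixedSpace K)` (`a ↦ a_∞`,
  inverse `g ↦ (g, 1) = GLn.ofInfinite g`), with `continuous_placesFactorEmptyEquiv(_symm)` —
  a topological group isomorphism, so Haar measures correspond (Mathlib
  `MulEquiv.isHaarMeasure_map`);
* `adelicAbsDet_eq_norm_det_toMixed_of_sndHom_eq_one` — **for `g` with trivial finite part,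
  `|det g|_𝔸 = |det g_∞|_∞ = ∏_{w ∣ ∞} ‖det g_w‖^{[K_w:ℝ]}`** (Mathlib
  `NumberField.mixedEmbedding.norm` of `det (GLn.toMixed g)`): the finite factors of the idelic
  norm are `1` and the archimedean ones are read through the isometries `K_w ≅ ℝ, ℂ`
  (Cassels–Fröhlich, Ch. II §16; Weil, *Basic Number Theory*, Ch. IV §4);
* `adelicMatrixFinite_coe_eq_one_of_sndHom_eq_one`, `adelicMatrixArch_coe_eq_of_symm` — the
  coordinates of such `g` entering a factorizable Schwartz–Bruhat function `Φ_∞ ⊗ Φ_f`.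

Everything here is proved; one definition (`placesFactorEmptyEquiv`, a `MulEquiv` with body).

## References

* R. Godement, H. Jacquet, *Zeta functions of simple algebras*, LNM 260 (1972), §12
  [GodementJacquet1972].
* J. W. S. Cassels, A. Fröhlich (eds.), *Algebraic Number Theory* (1967), Ch. II §14, §16
  [CasselsFrohlichANT1967].
-/

noncomputable section

open scoped MatrixGroups NNReal Classical
open NumberField NumberField.InfinitePlace NumberField.mixedEmbedding IsDedekindDomain

namespace Literature.NumberTheory.Automorphic

variable (K : Type) [Field K] [NumberField K] (n : ℕ)

/-! ### Elements with trivial finite part -/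

/-- Elements of `G_∅ = placesFactor K n ∅` have all finite local components `1`. [folklore] -/
theorem toLocal_coe_placesFactor_empty (a : placesFactor K n ∅) (w : HeightOneSpectrum (𝓞 K)) :
    (AdelicGroupData.gl n K).toLocal w (a : GL (Fin n) (AdeleRing (𝓞 K) K)) = 1 :=
  (mem_range_truncGL_one_sub_adeleAwayIdem_iff n ∅ a.1).1 a.2 w (Finset.notMem_empty w)

variable {K n} in
/-- An adelic invertible matrix all of whose finite local components are `1` has finite part `1`
(a finite adele is determined by its components). [folklore] -/
theorem GLn.sndHom_eq_one_of_forall_toLocal_eq_one {g : GL (Fin n) (AdeleRing (𝓞 K) K)}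
    (h : ∀ w : HeightOneSpectrum (𝓞 K), (AdelicGroupData.gl n K).toLocal w g = 1) :
    GLn.sndHom n K g = 1 := by
  refine Matrix.GeneralLinearGroup.ext fun i j => FiniteAdeleRing.ext K fun w => ?_
  have hw := (Matrix.GeneralLinearGroup.ext_iff _ _).1 (h w) i j
  rw [AdelicGroupData.gl_toLocal] at hw
  change AdelicGroupData.adeleEval K w ((g : Matrix (Fin n) (Fin n) (AdeleRing (𝓞 K) K)) i j) =
    (1 : Matrix (Fin n) (Fin n) (w.adicCompletion K)) i j at hw
  rw [AdelicGroupData.adeleEval_apply] at hw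
  change (((g : Matrix (Fin n) (Fin n) (AdeleRing (𝓞 K) K)) i j).2) w =
    ((1 : Matrix (Fin n) (Fin n) (FiniteAdeleRing (𝓞 K) K)) i j) w
  rw [hw, Matrix.one_apply, Matrix.one_apply]
  split_ifs <;> rfl

/-- Elements of `G_∅` have finite part `1`. [folklore] -/
theorem sndHom_coe_placesFactor_empty (a : placesFactor K n ∅) :
    GLn.sndHom n K (a : GL (Fin n) (AdeleRing (𝓞 K) K)) = 1 :=
  GLn.sndHom_eq_one_of_forall_toLocal_eq_one (toLocal_coe_placesFactor_empty K n a)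

variable {K n} in
/-- If `g_f = 1` then `g = (g_∞, 1) = GLn.ofInfinite (GLn.toMixed g)`. [folklore] -/
theorem GLn.ofInfinite_toMixed_of_sndHom_eq_one {g : GL (Fin n) (AdeleRing (𝓞 K) K)}
    (hg : GLn.sndHom n K g = 1) : GLn.ofInfinite n K (GLn.toMixed n K g) = g := by
  conv_rhs => rw [← GLn.ofInfinite_toMixed_mul_ofFinite_sndHom g]
  rw [hg, map_one, mul_one]

variable {K n} in
/-- `GLn.ofInfinite g` lies in `G_∅` (its finite local components are `1`). [folklore] -/
theorem GLn.ofInfinite_mem_placesFactor_empty (g : GL (Fin n) (mixedSpace K)) :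
    GLn.ofInfinite n K g ∈ placesFactor K n ∅ := by
  refine (mem_range_truncGL_one_sub_adeleAwayIdem_iff n ∅ _).2 fun w _ => ?_
  refine Matrix.GeneralLinearGroup.ext fun i j => ?_
  rw [AdelicGroupData.gl_toLocal]
  change AdelicGroupData.adeleEval K w
      ((GLn.ofInfinite n K g : Matrix (Fin n) (Fin n) (AdeleRing (𝓞 K) K)) i j) =
    (1 : Matrix (Fin n) (Fin n) (w.adicCompletion K)) i j
  rw [AdelicGroupData.adeleEval_apply, GLn.coe_ofInfinite_apply]
  change ((1 : Matrix (Fin n) (Fin n) (FiniteAdeleRing (𝓞 K) K)) i j) w = _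
  rw [Matrix.one_apply, Matrix.one_apply]
  split_ifs <;> rfl

/-! ### `G_∅ ≅ GL_n(K_∞)` as topological groups -/

/-- **`G_∅ ≅ GL_n(K_∞)`**: the archimedean factor `placesFactor K n ∅` of `GL_n(𝔸_K)` is
isomorphic to the real group `GL (Fin n) (mixedSpace K)` by `a ↦ a_∞` (`GLn.toMixed`), with inverse
`g ↦ (g, 1)` (`GLn.ofInfinite`). Borel–Jacquet (1979), §4.1 (`G(𝔸) = G_∞ × G(𝔸_f)`).
[cite: BorelJacquet1979, §4.1] -/
def placesFactorEmptyEquiv : placesFactor K n ∅ ≃* GL (Fin n) (mixedSpace K) where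
  toFun a := GLn.toMixed n K (a : GL (Fin n) (AdeleRing (𝓞 K) K))
  invFun g := ⟨GLn.ofInfinite n K g, GLn.ofInfinite_mem_placesFactor_empty g⟩
  left_inv a := Subtype.ext (GLn.ofInfinite_toMixed_of_sndHom_eq_one
    (sndHom_coe_placesFactor_empty K n a))
  right_inv g := GLn.toMixed_ofInfinite g
  map_mul' a b := by
    change GLn.toMixed n K ((a : GL (Fin n) (AdeleRing (𝓞 K) K)) * b) = _
    rw [map_mul]

variable {K n} in
/-- Unfolding `placesFactorEmptyEquiv`. [folklore] -/
@[simp]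
theorem placesFactorEmptyEquiv_apply (a : placesFactor K n ∅) :
    placesFactorEmptyEquiv K n a = GLn.toMixed n K (a : GL (Fin n) (AdeleRing (𝓞 K) K)) := rfl

variable {K n} in
/-- Unfolding the inverse of `placesFactorEmptyEquiv`. [folklore] -/
@[simp]
theorem coe_placesFactorEmptyEquiv_symm_apply (g : GL (Fin n) (mixedSpace K)) :
    (((placesFactorEmptyEquiv K n).symm g : placesFactor K n ∅) : GL (Fin n) (AdeleRing (𝓞 K) K)) =
      GLn.ofInfinite n K g := rfl

/-- `a ↦ a_∞` is continuous on `G_∅`. [folklore] -/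
theorem continuous_placesFactorEmptyEquiv : Continuous (placesFactorEmptyEquiv K n) :=
  (GLn.continuous_toMixed n K).comp continuous_subtype_val

/-- `g ↦ (g, 1)` is continuous into `G_∅`. [folklore] -/
theorem continuous_placesFactorEmptyEquiv_symm : Continuous (placesFactorEmptyEquiv K n).symm :=
  (GLn.continuous_ofInfinite n K).subtype_mk _

/-! ### Coordinates and module of elements with trivial finite part -/

variable {K n}

/-- The finite coordinates of `g` with `g_f = 1` are the identity matrix. [folklore] -/
theorem adelicMatrixFinite_coe_eq_one_of_sndHom_eq_one {g : GL (Fin n) (AdeleRing (𝓞 K) K)}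
    (hg : GLn.sndHom n K g = 1) :
    adelicMatrixFinite n K (g : Matrix (Fin n) (Fin n) (AdeleRing (𝓞 K) K)) = 1 := by
  have h := congrArg (fun h : GL (Fin n) (FiniteAdeleRing (𝓞 K) K) =>
    (h : Matrix (Fin n) (Fin n) (FiniteAdeleRing (𝓞 K) K))) hg
  rw [Units.val_one] at h
  exact h

/-- The archimedean coordinates of `g` are the entries of `g_∞ = GLn.toMixed g` (the tree's
`adelicMatrixArch_coe`, restated through `Matrix.of.symm` for the Schwartz-function side).
[folklore] -/
theorem adelicMatrixArch_coe_eq_of_symm (g : GL (Fin n) (AdeleRing (𝓞 K) K)) :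
    adelicMatrixArch n K (g : Matrix (Fin n) (Fin n) (AdeleRing (𝓞 K) K)) =
      Matrix.of.symm ((GLn.toMixed n K g : GL (Fin n) (mixedSpace K)) :
        Matrix (Fin n) (Fin n) (mixedSpace K)) :=
  adelicMatrixArch_coe n K g

/-- The finite component of the determinant is the determinant of the finite component:
`(det g)_f = det (g_f)`. [folklore] -/
theorem snd_coe_det (g : GL (Fin n) (AdeleRing (𝓞 K) K)) :
    ((Matrix.GeneralLinearGroup.det g : (AdeleRing (𝓞 K) K)ˣ) : AdeleRing (𝓞 K) K).2 =
      ((GLn.sndHom n K g : GL (Fin n) (FiniteAdeleRing (𝓞 K) K)) :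
        Matrix (Fin n) (Fin n) (FiniteAdeleRing (𝓞 K) K)).det := by
  rw [Matrix.GeneralLinearGroup.val_det_apply]
  exact RingHom.map_det (RingHom.snd (InfiniteAdeleRing K) (FiniteAdeleRing (𝓞 K) K)) _

/-- `det (g_∞)` read in `mixedSpace K` is `ringEquiv_mixedSpace` of `det (g_∞)` read in `K_∞`.
[folklore] -/
theorem coe_det_toMixed (g : GL (Fin n) (AdeleRing (𝓞 K) K)) :
    ((GLn.toMixed n K g : GL (Fin n) (mixedSpace K)) : Matrix (Fin n) (Fin n) (mixedSpace K)).det =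
      InfiniteAdeleRing.ringEquiv_mixedSpace K
        ((GLn.fstHom n K g : GL (Fin n) (InfiniteAdeleRing K)) :
          Matrix (Fin n) (Fin n) (InfiniteAdeleRing K)).det := by
  rw [GLn.toMixed_apply]
  exact (RingHom.map_det (InfiniteAdeleRing.ringEquiv_mixedSpace K).toRingHom
    ((GLn.fstHom n K g : GL (Fin n) (InfiniteAdeleRing K)) :
      Matrix (Fin n) (Fin n) (InfiniteAdeleRing K))).symm

variable (K) in
/-- The archimedean module is read through the isometries `K_w ≅ ℝ`, `K_w ≅ ℂ`:
`|ι(t)|_∞ = ∏_w ‖t_w‖^{[K_w:ℝ]}` for `t ∈ K_∞` and `ι = ringEquiv_mixedSpace`. [folklore] -/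
theorem mixedEmbedding_norm_ringEquiv_mixedSpace (t : InfiniteAdeleRing K) :
    mixedEmbedding.norm (InfiniteAdeleRing.ringEquiv_mixedSpace K t) =
      ∏ w : InfinitePlace K, ‖t w‖ ^ w.mult := by
  rw [mixedEmbedding.norm_apply]
  refine Finset.prod_congr rfl fun w _ => ?_
  congr 1
  by_cases hw : w.IsReal
  · rw [normAtPlace_apply_of_isReal hw, InfiniteAdeleRing.ringEquiv_mixedSpace_apply]
    exact (InfinitePlace.Completion.isometry_extensionEmbeddingOfIsReal hw).norm_map_of_map_zero
      (map_zero _) _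
  · have hw' : w.IsComplex := not_isReal_iff_isComplex.1 hw
    rw [normAtPlace_apply_of_isComplex hw', InfiniteAdeleRing.ringEquiv_mixedSpace_apply]
    exact (InfinitePlace.Completion.isometry_extensionEmbedding w).norm_map_of_map_zero
      (map_zero _) _

/-- **`|det g|_𝔸 = |det g_∞|_∞` when `g_f = 1`**: for an adelic invertible matrix with trivial
finite part, the idelic norm of its determinant is the archimedean module
`∏_{w ∣ ∞} ‖det g_w‖^{[K_w:ℝ]} = mixedEmbedding.norm (det (GLn.toMixed g))` (the finite local
factors are `‖1‖_v = 1`; Cassels–Fröhlich, Ch. II §16). [folklore] -/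
theorem adelicAbsDet_eq_norm_det_toMixed_of_sndHom_eq_one {g : GL (Fin n) (AdeleRing (𝓞 K) K)}
    (hg : GLn.sndHom n K g = 1) :
    (adelicAbsDet n K g : ℝ) =
      mixedEmbedding.norm (((GLn.toMixed n K g : GL (Fin n) (mixedSpace K)) :
        Matrix (Fin n) (Fin n) (mixedSpace K)).det) := by
  rw [adelicAbsDet_apply, ideleNorm_apply, coe_det_toMixed,
    mixedEmbedding_norm_ringEquiv_mixedSpace, ← fst_coe_det]
  have hfin : ∀ v : HeightOneSpectrum (𝓞 K),
      ‖((Matrix.GeneralLinearGroup.det g : (AdeleRing (𝓞 K) K)ˣ) : AdeleRing (𝓞 K) K).2 v‖₊ = 1 := by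
    intro v
    rw [snd_coe_det, hg, Units.val_one, Matrix.det_one, show (1 : FiniteAdeleRing (𝓞 K) K) v = 1 from rfl,
      nnnorm_one]
  rw [finprod_eq_one_of_forall_eq_one hfin, mul_one]
  push_cast
  rfl

end Literature.NumberTheory.Automorphic
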